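import Mathlib
import Summits.ValiantsHypothesis.ValiantsHypothesis.Theorems.BarrierLeverPartitionMinorsHitByVPHiddenStatesPairBall
import Summits.ValiantsHypothesis.ValiantsHypothesis.Theorems.BarrierLeverPartitionMinorsHitByVPHiddenStatesJoinUniform

/-!
# Route BarrierLever — item `PartitionMinorsHitByVP` (stmt-ValiantsHypothesis-19717), line `hidden_states`:
# THE PAIR-BALL JOIN — BP ⇒ the conjecture node `stub_universalJoinWide` at `r = m(1 + K + C(b,2))`

Helper file (`--supports stmt-ValiantsHypothesis-19717`; cell valiant-natproofs, rung V4, 𝒟-side door (c), line `hidden_states`,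
node #1 `stub_universalJoinWide`; prover seat val-np-p3 gen 20; seat memo MEMO-blockpeeling-valnp3-g20 §12–§13). Bookkeeping `def`s
only (`wt`, `cheap`, `members`, `design`: an explicit legal wide join threshold family). Closes NO item.

THE DESIGN. `m` pieces of `K` states; in every piece the states `q < b` are CHEAP (weight 1) and the others FREE (weight 2); the
members are ALL (piece, state set) of weight `≤ 2` — origin, singles, cheap pairs: `1 + K + C(b,2)` per piece — enumerated by
`Finset.equivFin` (`design`), so injectivity and the strict threshold are free. Every piece is a pair-ball piece (`PairBall.IsPairBall`),
UNIFORM under BP (`PairBall.exists_table`), and uniform pieces compose (`SimplexJoin.good_of_uniform_pieces_join`).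
* `card_members : #members = m · (1 + K + C(b,2))` (`b ≤ K`).
* **`universalJoinWide_of_bp2`**: `(∀ n, PairBall.Stmt.bp2 β₁ β₂ h n)` ⇒ for all `m ≤ 2h`, `β₁ ≤ b ≤ β₂`, `b ≤ K ≤ h³` the body of
  `Stmt.stub_universalJoinWide` holds at `(h, r = m(1 + K + C(b,2)))` — up to `r = 2h(1 + h³ + C(h³,2)) ≈ h⁷` (vs `2h⁴ + 2h` of star
  joins), FOR ALL injective `u`. With the census (kit j330545/j330766) and the pair laws the window of record is `h^{5/2}/7 ≲ b ≲ h³/8`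
  (`r ≲ h⁷/64`): BP on that window is the single by-name sufficient condition of the block programme for the node's polynomial table.
WHAT THIS IS NOT: BP is not proved; other `r` need mixed piece shapes (routine, not done); item 19717 OPEN; nothing on 14610 / VP ≠ VNP.
-/

set_option linter.dupNamespace false

namespace Summit.ValiantsHypothesis.ValiantsHypothesis.Theorems.BarrierLever.HiddenStates

open Finset Matrix

noncomputable section

namespace PairBallJoin

variable {h m K : ℕ}

/-! ## 1. The design -/

/-- State weights: cheap states (`q < b`) weigh `1`, free states weigh `2`. -/
def wt (b : ℕ) (q : Fin K) : ℕ := if (q : ℕ) < b then 1 else 2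

/-- The cheap states of a piece. -/
def cheap (K b : ℕ) : Finset (Fin K) := Finset.univ.filter fun q : Fin K => (q : ℕ) < b

/-- The members of the design: every (piece, state set) of weight `≤ 2`. -/
def members (m K b : ℕ) : Finset (Fin m × Finset (Fin K)) :=
  Finset.univ.filter fun x : Fin m × Finset (Fin K) => ∑ q ∈ x.2, wt b q ≤ 2

/-- The design: an enumeration of the members. -/
def design (m K b : ℕ) (k : Fin (members m K b).card) : Fin m × Finset (Fin K) :=
  (((members m K b).equivFin.symm k : members m K b) : Fin m × Finset (Fin K))

/-- Every state weighs at least `1`. -/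
theorem one_le_wt (b : ℕ) (q : Fin K) : 1 ≤ wt b q := by unfold wt; split_ifs <;> omega

/-- Every state weighs at most `2`. -/
theorem wt_le_two (b : ℕ) (q : Fin K) : wt b q ≤ 2 := by unfold wt; split_ifs <;> omega

/-- Membership in the cheap set. -/
theorem mem_cheap {b : ℕ} {q : Fin K} : q ∈ cheap K b ↔ (q : ℕ) < b := by simp [cheap]

/-- Cheap states weigh `1`. -/
theorem wt_of_mem_cheap {b : ℕ} {q : Fin K} (hq : q ∈ cheap K b) : wt b q = 1 := by
  unfold wt; rw [if_pos (mem_cheap.mp hq)]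

/-- Free states weigh `2`. -/
theorem wt_of_not_mem_cheap {b : ℕ} {q : Fin K} (hq : q ∉ cheap K b) : wt b q = 2 := by
  unfold wt; rw [if_neg (fun hh => hq (mem_cheap.mpr hh))]

/-- The design enumerates members. -/
theorem design_mem (m K b : ℕ) (k : Fin (members m K b).card) : design m K b k ∈ members m K b :=
  ((members m K b).equivFin.symm k).2

/-- The design is injective. -/
theorem design_injective (m K b : ℕ) : Function.Injective (design m K b) := by
  intro k k' hkk'
  exact (members m K b).equivFin.symm.injective (Subtype.ext hkk')

/-- Every member is in the range of the design. -/
theorem mem_range_design {m K b : ℕ} {x : Fin m × Finset (Fin K)} (hx : x ∈ members m K b) :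
    x ∈ Set.range (design m K b) :=
  ⟨(members m K b).equivFin ⟨x, hx⟩, by simp [design]⟩

/-- Members weigh at most `2`. -/
theorem weight_le_two_of_mem {m K b : ℕ} {x : Fin m × Finset (Fin K)} (hx : x ∈ members m K b) :
    ∑ q ∈ x.2, wt b q ≤ 2 := (Finset.mem_filter.mp hx).2

/-- The strict threshold: members weigh `≤ 2`, everything outside the range weighs `≥ 3` (piece offsets `0`). -/
theorem design_threshold (m K b : ℕ) :
    ∀ x : Fin m × Finset (Fin K), x ∉ Set.range (design m K b) →
      ∀ i, (fun _ : Fin m => 0) (design m K b i).1 + ∑ q ∈ (design m K b i).2, (fun _ : Fin m => wt b) (design m K b i).1 q <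
        (fun _ : Fin m => 0) x.1 + ∑ q ∈ x.2, (fun _ : Fin m => wt b) x.1 q := by
  intro x hx i
  have hxw : ¬ ∑ q ∈ x.2, wt b q ≤ 2 := fun hh => hx (mem_range_design (Finset.mem_filter.mpr ⟨Finset.mem_univ _, hh⟩))
  have hiw := weight_le_two_of_mem (design_mem m K b i)
  simp only [zero_add]
  omega

/-! ## 2. The shape of the members -/

/-- The cardinality of a state set is at most its weight. -/
theorem card_le_weight (b : ℕ) (J : Finset (Fin K)) : J.card ≤ ∑ q ∈ J, wt b q := by
  rw [Finset.card_eq_sum_ones]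
  exact Finset.sum_le_sum fun q _ => one_le_wt b q

/-- A nonempty member set is a cheap single, a cheap pair, or a free single. -/
theorem shape_of_weight_le_two {b : ℕ} (J : Finset (Fin K)) (hJ : ∑ q ∈ J, wt b q ≤ 2) (hne : J ≠ ∅) :
    J ⊆ cheap K b ∧ (J.card = 1 ∨ J.card = 2) ∨ ∃ f, f ∉ cheap K b ∧ J = {f} := by
  classical
  have hcard : J.card ≤ 2 := (card_le_weight b J).trans hJ
  have hpos : 0 < J.card := Finset.card_pos.mpr (Finset.nonempty_iff_ne_empty.mpr hne)
  by_cases hall : ∀ q ∈ J, q ∈ cheap K b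
  · exact Or.inl ⟨fun q hq => hall q hq, by omega⟩
  · push Not at hall
    obtain ⟨f, hfJ, hf⟩ := hall
    refine Or.inr ⟨f, hf, ?_⟩
    have hsplit : ∑ q ∈ J, wt b q = wt b f + ∑ q ∈ J.erase f, wt b q := (Finset.add_sum_erase J _ hfJ).symm
    have hrest : (J.erase f).card ≤ ∑ q ∈ J.erase f, wt b q := card_le_weight b _
    rw [wt_of_not_mem_cheap hf] at hsplit
    have h0 : (J.erase f).card = 0 := by omega
    have hJ1 : J.card = 1 := by rw [Finset.card_erase_of_mem hfJ] at h0; omega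
    obtain ⟨f', hf'⟩ := Finset.card_eq_one.mp hJ1
    rw [hf'] at hfJ
    rw [hf', Finset.mem_singleton.mp hfJ]

/-! ## 3. Counting the members -/

/-- There are `b` cheap states (`b ≤ K`). -/
theorem card_cheap {b : ℕ} (hb : b ≤ K) : (cheap K b).card = b := by
  have hmap : cheap K b = Finset.univ.map (Fin.castLEEmb hb) := by
    ext q
    simp only [cheap, Finset.mem_filter, Finset.mem_univ, true_and, Finset.mem_map, Fin.castLEEmb_apply]
    exact ⟨fun hq => ⟨⟨q, hq⟩, Fin.ext rfl⟩, fun ⟨j, hj⟩ => hj ▸ j.2⟩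
  rw [hmap, Finset.card_map, Finset.card_univ, Fintype.card_fin]

/-- The member state sets of one piece: the sets of size `≤ 1` and the cheap pairs. -/
theorem filter_weight_eq {b : ℕ} (hb : b ≤ K) :
    (Finset.univ.filter fun J : Finset (Fin K) => ∑ q ∈ J, wt b q ≤ 2) =
      (Finset.univ.powersetCard 0 ∪ Finset.univ.powersetCard 1) ∪ (cheap K b).powersetCard 2 := by
  classical
  have _ := hb
  ext J
  simp only [Finset.mem_filter, Finset.mem_univ, true_and, Finset.mem_union, Finset.mem_powersetCard,
    Finset.subset_univ]
  constructor
  · intro hJ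
    by_cases hne : J = ∅
    · exact Or.inl (Or.inl (by rw [hne, Finset.card_empty]))
    · rcases shape_of_weight_le_two J hJ hne with ⟨hsub, h1 | h2⟩ | ⟨f, -, hf⟩
      · exact Or.inl (Or.inr h1)
      · exact Or.inr ⟨hsub, h2⟩
      · exact Or.inl (Or.inr (by rw [hf, Finset.card_singleton]))
  · rintro ((h0 | h1) | ⟨hsub, h2⟩)
    · rw [Finset.card_eq_zero.mp h0, Finset.sum_empty]; omega
    · obtain ⟨q, rfl⟩ := Finset.card_eq_one.mp h1
      rw [Finset.sum_singleton]; exact wt_le_two b q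
    · rw [Finset.sum_congr rfl fun q hq => wt_of_mem_cheap (hsub hq)]
      simp [h2]

/-- **`#members = m · (1 + K + C(b,2))`.** -/
theorem card_members (m : ℕ) {b : ℕ} (hb : b ≤ K) : (members m K b).card = m * (1 + K + b.choose 2) := by
  classical
  have hprod : members m K b =
      (Finset.univ : Finset (Fin m)) ×ˢ (Finset.univ.filter fun J : Finset (Fin K) => ∑ q ∈ J, wt b q ≤ 2) := by
    ext x
    simp [members]
  have hS : (Finset.univ.filter fun J : Finset (Fin K) => ∑ q ∈ J, wt b q ≤ 2).card = 1 + K + b.choose 2 := by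
    rw [filter_weight_eq hb, Finset.card_union_of_disjoint, Finset.card_union_of_disjoint, Finset.card_powersetCard,
      Finset.card_powersetCard, Finset.card_powersetCard, card_cheap hb, Finset.card_univ, Fintype.card_fin]
    · simp
    · exact Finset.disjoint_left.mpr fun J h0 h1 => by
        rw [Finset.mem_powersetCard] at h0 h1; omega
    · exact Finset.disjoint_left.mpr fun J h01 h2 => by
        rw [Finset.mem_union, Finset.mem_powersetCard, Finset.mem_powersetCard] at h01
        rw [Finset.mem_powersetCard] at h2
        omega
  rw [hprod, Finset.card_product, hS, Finset.card_univ, Fintype.card_fin]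

/-! ## 4. Every piece is a uniform pair-ball piece -/

/-- **BP ⇒ the pair-ball join is good for every injective `u`.** -/
theorem design_good {β₁ β₂ : ℕ} (hBP : ∀ n, PairBall.Stmt.bp2 β₁ β₂ h n) (m K b : ℕ) (hb : b ≤ K) (hβ : β₁ ≤ b) (hβ' : b ≤ β₂)
    (u : Fin (members m K b).card → Finset (Fin h)) (hu : Function.Injective u) :
    ∃ T : Fin m → Option (Fin K) → Fin h → ℂ,
      (Matrix.of fun i k : Fin (members m K b).card => ∏ a ∈ u i,
        (T (design m K b k).1 none a + ∑ q ∈ (design m K b k).2, T (design m K b k).1 (some q) a)).det ≠ 0 := by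
  classical
  refine SimplexJoin.good_of_uniform_pieces_join h m K _ u (design m K b) hu (design_injective m K b) ?_
  intro p n c hc hcp hsurj v hv
  -- the columns of the piece `p`, in the order `c`
  set cols : Fin n → Finset (Fin K) := fun x => (design m K b (c x)).2 with hcols
  have hcols_inj : Function.Injective cols := by
    intro x x' hxx'
    have : design m K b (c x) = design m K b (c x') := Prod.ext ((hcp x).trans (hcp x').symm) hxx'
    exact hc (design_injective m K b this)
  -- the origin of the piece is one of its columns
  have h0mem : ((p, (∅ : Finset (Fin K))) : Fin m × Finset (Fin K)) ∈ members m K b :=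
    Finset.mem_filter.mpr ⟨Finset.mem_univ _, by simp⟩
  obtain ⟨k₀', hk₀'⟩ := mem_range_design h0mem
  obtain ⟨x₀, hx₀⟩ := hsurj k₀' (by rw [hk₀'])
  have hcols0 : cols x₀ = ∅ := by simp only [hcols, hx₀, hk₀']
  -- so `n = n' + 1`
  obtain ⟨n', rfl⟩ : ∃ n', n = n' + 1 := ⟨n - 1, by have := x₀.2; omega⟩
  -- the other columns form a pair-ball family with cheap set `cheap K b`
  have hshape : PairBall.IsPairBall (fun x : Fin n' => cols (x₀.succAbove x)) (cheap K b) := by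
    refine ⟨fun x x' hxx' => Fin.succAbove_right_injective (hcols_inj hxx'), fun x => ?_⟩
    have hmem : design m K b (c (x₀.succAbove x)) ∈ members m K b := design_mem m K b _
    have hw := weight_le_two_of_mem hmem
    have hne : cols (x₀.succAbove x) ≠ ∅ := by
      intro hh
      have : cols (x₀.succAbove x) = cols x₀ := hh.trans hcols0.symm
      exact Fin.succAbove_ne x₀ x (hcols_inj this)
    exact shape_of_weight_le_two _ hw hne
  -- the block is complete: every cheap single / pair is a member of the piece, hence a column other than the origin
  have hmemcol : ∀ J : Finset (Fin K), (p, J) ∈ members m K b → J ≠ ∅ → ∃ x : Fin n', cols (x₀.succAbove x) = J := by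
    intro J hJ hJne
    obtain ⟨k, hk⟩ := mem_range_design hJ
    obtain ⟨x, hx⟩ := hsurj k (by rw [hk])
    have hx0 : x ≠ x₀ := by
      intro hh
      apply hJne
      have : cols x = J := by simp only [hcols, hx, hk]
      rw [← this, hh, hcols0]
    obtain ⟨x', rfl⟩ := Fin.exists_succAbove_eq hx0
    exact ⟨x', by simp only [hcols, hx, hk]⟩
  have hcomplete : PairBall.IsComplete (fun x : Fin n' => cols (x₀.succAbove x)) (cheap K b) := by
    refine ⟨fun q hq => hmemcol {q} ?_ (Finset.singleton_ne_empty q), fun q hq q' hq' hqq' => hmemcol {q, q'} ?_ ?_⟩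
    · exact Finset.mem_filter.mpr ⟨Finset.mem_univ _, by simp [wt_of_mem_cheap hq]⟩
    · exact Finset.mem_filter.mpr ⟨Finset.mem_univ _, by simp [Finset.sum_pair hqq', wt_of_mem_cheap hq, wt_of_mem_cheap hq']⟩
    · exact (Finset.insert_nonempty q {q'}).ne_empty
  have hβ₁ : β₁ ≤ (cheap K b).card := by rw [card_cheap hb]; exact hβ
  have hβ₂ : (cheap K b).card ≤ β₂ := by rw [card_cheap hb]; exact hβ'
  exact PairBall.exists_table (hBP n') cols x₀ hcols0 (cheap K b) hshape hβ₁ hβ₂ hcomplete v hv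

/-! ## 5. The node in range -/

/-- **BP ⇒ THE CONJECTURE NODE AT `r = m(1 + K + C(b,2))`.** For `m ≤ 2h` pieces, `b ≤ K ≤ h³`: the body of
`Stmt.stub_universalJoinWide` (line `hidden_states`) holds at `(h, r)` for ALL injective row families. -/
theorem universalJoinWide_of_bp2 {β₁ β₂ : ℕ} (hBP : ∀ n, PairBall.Stmt.bp2 β₁ β₂ h n) (m K b r : ℕ) (hm : m ≤ h + h)
    (hK : K ≤ h * h * h) (hb : b ≤ K) (hβ : β₁ ≤ b) (hβ' : b ≤ β₂) (hr : r = m * (1 + K + b.choose 2)) :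
    ∃ (m K : ℕ) (W : Fin m → ℕ) (wt : Fin m → Fin K → ℕ) (e : Fin r → Fin m × Finset (Fin K)),
      m ≤ h + h ∧ K ≤ h * h * h ∧ Function.Injective e ∧
      (∀ x : Fin m × Finset (Fin K), x ∉ Set.range e →
        ∀ i, W (e i).1 + ∑ k ∈ (e i).2, wt (e i).1 k < W x.1 + ∑ k ∈ x.2, wt x.1 k) ∧
      ∀ u : Fin r → Finset (Fin h), Function.Injective u →
        ∃ tx : Fin m → Option (Fin K) → Fin h → ℂ,
          (Matrix.of fun i k : Fin r =>
            ∏ a ∈ u i, (tx (e k).1 none a + ∑ q ∈ (e k).2, tx (e k).1 (some q) a)).det ≠ 0 := by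
  classical
  have hcard : (members m K b).card = r := by rw [card_members m hb, hr]
  subst hcard
  refine ⟨m, K, fun _ => 0, fun _ => wt b, design m K b, hm, hK, design_injective m K b, design_threshold m K b, ?_⟩
  intro u hu
  exact design_good hBP m K b hb hβ hβ' u hu

end PairBallJoin

end

end Summit.ValiantsHypothesis.ValiantsHypothesis.Theorems.BarrierLever.HiddenStates
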